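import Literature.NumberTheory.Automorphic.Liu2021.LemD1Item3AtVOfSeparation
import Literature.NumberTheory.GelbartRogawski1991.LocalLineModelTransport
import HarnessLib

/-!
# [Liu2021, Lem. D.1 (3)] on `localIndexedFamilyAtV … (Equiv.prodUnique (Fin 3) (Fin 1)) … v`, `(ε, χ)`-clauses (→) at a NON-SPLIT
# place — the transport chain of `LemD1Item3AtVOfSeparation.lean` INSTANTIATED at the `e′_a` line-model transport — THEOREMS ONLY

Topic `NumberTheory/Automorphic/Liu2021`; namespace `Literature.NumberTheory.Automorphic.Liu2021.Def411WeilCarriers`.  KERNEL ONLY: one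
private plumbing lemma and three theorems; no definition, no named fact, no `sorry`.  Nothing of [Liu2021] is asserted: the `ε`-separation row
IV-4c1 `rankOne_theta_lines_disjoint` (D-0014) is the HYPOTHESIS `h`.

**What is proved** (§1; cell hodgecm-mathlib, fan A, line `a4-liuD3`, stub (:185) `stub_sameClass_and_chi_of_iso_nonsplit`; the stub's statement is
this theorem at the `hDel`/`hD3` datum `F⁺ ⊂ F`, `c`, `δ = imagUnit F`, `T_V = realDiagonal dV`, `𝓢_t` the `χ`-splitting family):
`sameClass_and_chi_eq_of_areIsomorphicRep_nonsplit_prodUnique` — for the indexed family of [Liu2021, App. D §D.1]'s data at `v` built at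
the reindexing `Equiv.prodUnique (Fin 3) (Fin 1)` (so the pair Gram matrix of member `t` is `a_t • T_V` and `𝒮(F_v³)` is common to all
models), `E_v` a FIELD and `h : rankOne_theta_lines_disjoint`: «`ω(μ_j, ε_j, χ_j) ≅ ω(μ_i, ε_i, χ_i)`» (`AreIsomorphicRep (quot j) (quot i)`)
forces `LemD1.SameClass (eps i) (eps j)` and `chi j = chi i`.  It is `sameClass_and_chi_eq_of_areIsomorphicRep_nonsplit_of_modelTransport`
(`LemD1Item3AtVOfSeparation.lean` §3: transport chain, MVW IV.2 non-vanishing PROVED, B-p13's separation package mod IV-4c1) with the transport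
data supplied by the tree's `e′_a` LINE-MODEL TRANSPORT (`GelbartRogawski1991/LocalLineModelTransport.lean`): `δ'_t = a_t⁻¹ δ`,
`s_t = lineTransportSection … (a_t) v ((𝓢_t).s v) ((𝓢_t).proj_s v)` over `ι_{δ'_t}` (`proj_lineTransportSection`), smooth
(`isSmooth_lineTransportSection`), `M_t = 1` (`omega_lineTransportSection_finLocalSplittings`: `ω_{s_t} = (𝓢_t).omegaLoc v ∘ (k ↦ k ⊗ 1)` ON THE
NOSE), and the class witness `(a_t δ) ⊗ 1 = u uᶜ ((a_t⁻¹ δ) ⊗ 1)`, `u = a_t ⊗ 1` (`epsLine_eq_mul_conj_mul_eps_lineDelta`, read backwards).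

§2 (consumer forms for the sibling stubs :190 ∕ :195, same transport): `areIsomorphicRep_theta_lineTransportSection_of_areIsomorphicRep_quot` —
«`quot j ≅ quot i`» ⟹ `Θ_{s_j}(χ_{j,v}) ≅ Θ_{s_i}(χ_{i,v})` at any common line `J₁` (any `N ≥ 3`, any `v`); `nontrivial_thetaCoinv_lineTransportSection_of_isField`
— `Θ_{s_t}(χ_{t,v}) ≠ 0` at a non-split `v`, `N = 3` (MVW IV.2 PROVED + isotropy).

HC_CM is proved only modulo the 7 printed citations (`hDel`, `h21`, `hLiu418`, `h411`, `h413`, `hD3`, `hD1''`) until rung 0 closes; this file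
discharges none of them and no interface fact.

## References
* [Liu2021] Y. Liu, Camb. J. Math. 9 (2021) = arXiv:2102.11518 — App. D §D.1 Steps 1–3 (l. 5213–5224), Lemma D.1 (3) (l. 5233), proof l. 5255.
* [MoeglinVignerasWaldspurger1987] C. Mœglin, M.-F. Vignéras, J.-L. Waldspurger, LNM 1291, Chap. 2 II.1, Chap. 3 IV.2, IV.4.
* [GelbartRogawski1990] S. Gelbart, J. Rogawski, PS-Festschrift I (1990), Prop. 5.1.4 (via [Liu2021]).
-/

set_option autoImplicit false

noncomputable section

open scoped Matrix Kronecker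
open NumberField IsDedekindDomain
open Literature.NumberTheory.Automorphic Literature.NumberTheory.Automorphic.UnitaryGroup
open Literature.RepresentationTheory
open Literature.RepresentationTheory.HeisenbergGroup (MpPsi)
open Literature.NumberTheory.GelbartRogawski1991 Literature.NumberTheory.GelbartRogawski1991.UnitaryDualPair
open Literature.NumberTheory.GelbartRogawski1991.UnitaryDualPair.LocalSplitting
open Literature.RepresentationTheory.MoeglinVignerasWaldspurger1987

namespace Literature.NumberTheory.Automorphic.Liu2021.Def411WeilCarriers

variable (F E : Type) [Field F] [NumberField F] [Field E] [NumberField E] [Algebra F E]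
variable (c : E ≃ₐ[F] E) (JV : Matrix (Fin 3) (Fin 3) E) {TV : Matrix (Fin 3) (Fin 3) F}
variable [Algebra.IsQuadraticExtension F E] {δ : E} (hcδ : c δ = -δ) (hδ : δ ≠ 0) {d : F} (hd : δ * δ = algebraMap F E d)

omit [NumberField F] [NumberField E] [Algebra.IsQuadraticExtension F E] in
/-- in a commutative group with an endomorphism `σ`: `a = z · σ z · b ⟹ b = z⁻¹ · σ z⁻¹ · a` (reads the class witness
`epsLine a = u uᶜ eps (δ/a)` backwards). [folklore] -/
private theorem eq_inv_mul_of_eq_mul' {G : Type*} [CommGroup G] (σ : G →* G) {a b z : G} (h : a = z * σ z * b) :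
    b = z⁻¹ * σ z⁻¹ * a := by
  rw [h, map_inv, mul_comm z⁻¹ (σ z)⁻¹]
  group

/-- **[Liu2021, App. D Lem. D.1 (3)], `(ε, χ)`-CLAUSES (→) AT A NON-SPLIT PLACE, on the indexed family at the reindexing
`Equiv.prodUnique (Fin 3) (Fin 1)`, CONDITIONAL on row IV-4c1** (`h : rankOne_theta_lines_disjoint`): for `E_v` a field and members `i, j`
of `localIndexedFamilyAtV F E c 3 (Equiv.prodUnique (Fin 3) (Fin 1)) J_V … v` (lines `⟨a_t⟩`, characters `χ_t`, ANY splitting families `𝓢_t` of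
the pair models `a_t • T_V`, ANY Step-2 characters `μ_{t,•}`), «`ω(μ_j, ε_j, χ_j) ≅ ω(μ_i, ε_i, χ_i)`» (`AreIsomorphicRep (quot j) (quot i)`,
READING L7) ⟹ `LemD1.SameClass (eps i) (eps j)` ∧ `chi j = chi i` — the `ε`- and `χ`-summands of `LemD1_3AsPrintedI`'s right-hand side.
Proof: `sameClass_and_chi_eq_of_areIsomorphicRep_nonsplit_of_modelTransport` at the `e′_a` transport of `LocalLineModelTransport.lean`
(`δ'_t = a_t⁻¹ δ`, `s_t = lineTransportSection …`, `M_t = 1`). [cite: Liu2021, App. D Lemma D.1 (3) (l. 5233), proof l. 5255 (= GelbartRogawski1990 Prop. 5.1.4, n = 3)]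
[cite: MoeglinVignerasWaldspurger1987, Chap. 2 II.1, Chap. 3 IV.2, IV.4] -/
theorem sameClass_and_chi_eq_of_areIsomorphicRep_nonsplit_prodUnique (h : rankOne_theta_lines_disjoint)
    (hV : TV.IsSymm) (hVd : IsUnit TV.det) (hJV : JV = TV.map (algebraMap F E))
    {ι : Type} (aOf : ι → Fˣ) (χOf : ι → Chi F E c)
    (𝓢Of : ∀ i, LocalSplitting.FinLocalSplittings F E c 3 hcδ hδ hd (gram F (Equiv.prodUnique (Fin 3) (Fin 1)) TV (TW F (aOf i)))
      (isSymm_gram F (Equiv.prodUnique (Fin 3) (Fin 1)) hV (isSymm_TW F (aOf i)))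
      (reindex_kronecker_eq_gram_map F E (Equiv.prodUnique (Fin 3) (Fin 1)) hJV (JW_eq F E (aOf i))))
    (μOf : ι → ∀ v : HeightOneSpectrum (𝓞 F), (LocalRing E v)ˣ →* ℂˣ) (hμn : ∀ i v x, ‖((μOf i v x : ℂˣ) : ℂ)‖ = 1)
    (hμc : ∀ i v, Continuous fun x => ((μOf i v x : ℂˣ) : ℂ))
    (hμF : ∀ (i : ι) (v : HeightOneSpectrum (𝓞 F)) (t : (v.adicCompletion F)ˣ),
      μOf i v (Units.map (algebraMap (v.adicCompletion F) (LocalRing E v)).toMonoidHom t) = 1 ↔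
        ∃ x : (LocalRing E v)ˣ, (x : LocalRing E v) * conjLocal E c v x = algebraMap (v.adicCompletion F) (LocalRing E v) t)
    (v : HeightOneSpectrum (𝓞 F)) (hE : IsField (LocalRing E v)) (i j : ι)
    (hiso : AreIsomorphicRep
      ((localIndexedFamilyAtV F E c 3 (Equiv.prodUnique (Fin 3) (Fin 1)) JV hcδ hδ hd hV hVd hJV (le_refl 3) aOf χOf 𝓢Of μOf hμn hμc hμF v).quot j)
      ((localIndexedFamilyAtV F E c 3 (Equiv.prodUnique (Fin 3) (Fin 1)) JV hcδ hδ hd hV hVd hJV (le_refl 3) aOf χOf 𝓢Of μOf hμn hμc hμF v).quot i)) :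
    LemD1.SameClass
        ((localIndexedFamilyAtV F E c 3 (Equiv.prodUnique (Fin 3) (Fin 1)) JV hcδ hδ hd hV hVd hJV (le_refl 3) aOf χOf 𝓢Of μOf hμn hμc hμF v).eps i)
        ((localIndexedFamilyAtV F E c 3 (Equiv.prodUnique (Fin 3) (Fin 1)) JV hcδ hδ hd hV hVd hJV (le_refl 3) aOf χOf 𝓢Of μOf hμn hμc hμF v).eps j) ∧
      (localIndexedFamilyAtV F E c 3 (Equiv.prodUnique (Fin 3) (Fin 1)) JV hcδ hδ hd hV hVd hJV (le_refl 3) aOf χOf 𝓢Of μOf hμn hμc hμF v).chi j =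
        (localIndexedFamilyAtV F E c 3 (Equiv.prodUnique (Fin 3) (Fin 1)) JV hcδ hδ hd hV hVd hJV (le_refl 3) aOf χOf 𝓢Of μOf hμn hμc hμF v).chi i :=
  sameClass_and_chi_eq_of_areIsomorphicRep_nonsplit_of_modelTransport F E c hcδ hδ hd (Equiv.prodUnique (Fin 3) (Fin 1)) JV h hV hVd hJV
    (le_refl 3) aOf χOf 𝓢Of μOf hμn hμc hμF v hE i j
    (fun t => algebraMap F E (↑(aOf t)⁻¹ : F) * δ) (fun t => conj_lineDelta hcδ (aOf t)) (fun t => lineDelta_ne_zero hδ (aOf t))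
    (fun t => ↑(aOf t)⁻¹ * ↑(aOf t)⁻¹ * d) (fun t => lineDelta_mul_self hd (aOf t))
    (fun t => ⟨_, eq_inv_mul_of_eq_mul' (Units.map (conjLocal E c v : LocalRing E v →* LocalRing E v))
      (epsLine_eq_mul_conj_mul_eps_lineDelta F E c (aOf t) v (hδ := hδ))⟩)
    (fun t => lineTransportSection F E c 3 hcδ hδ hd TV hV JV hJV (aOf t) v ((𝓢Of t).s v) ((𝓢Of t).proj_s v))
    (fun t g => proj_lineTransportSection F E c 3 hcδ hδ hd TV hV JV hJV (aOf t) v ((𝓢Of t).s v) ((𝓢Of t).proj_s v) g)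
    (fun t => isSmooth_lineTransportSection F E c 3 hcδ hδ hd TV hV JV hJV (aOf t) v ((𝓢Of t).s v) ((𝓢Of t).proj_s v) ((𝓢Of t).smooth v))
    (fun _ => LinearEquiv.refl ℂ _)
    (fun t g Φ => LinearMap.congr_fun
      (DFunLike.congr_fun (omega_lineTransportSection_finLocalSplittings F E c 3 hcδ hδ hd TV hV JV hJV (aOf t) v (𝓢Of t)) g) Φ)
    hiso


/-! ## §2 Consumer forms for the other «⇒» stubs of `a4-liuD3` (:190, :195): the family's «isomorphic» and the non-vanishing,
delivered in the δ-model currency of `RankOneThetaLift.lean` at the transported sections `s_t = lineTransportSection … (a_t) …` -/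

section Consumer

variable (N : ℕ) (JV' : Matrix (Fin N) (Fin N) E) {TV' : Matrix (Fin N) (Fin N) F}

/-- **«`ω(μ_j, ε_j, χ_j) ≅ ω(μ_i, ε_i, χ_i)`» ⟹ `Θ_{s_j}(χ_{j,v}) ≅ Θ_{s_i}(χ_{i,v})`** for the indexed family at the reindexing
`Equiv.prodUnique (Fin N) (Fin 1)` (any rank `N ≥ 3`, any place `v`), the transported sections
`s_t := lineTransportSection … (a_t) v ((𝓢_t).s v) ((𝓢_t).proj_s v)` on the COMMON model `LocalMp F N T_V v`, and ANY line `J₁` presenting the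
centre (`χ_{t,v} := localCharOfCenter … J₁ … (χ_t) v`): `areIsomorphicRep_theta_comp_uEquiv_quot` for `j` and `i` (with `M = 1`,
`omega_lineTransportSection_finLocalSplittings`) and descent along the onto map `uEquiv` (`AreIsomorphicRep.of_comp_surjective`).  The
`hiso` input of `rankOne_theta_epsClass_and_char_eq_of_areIsomorphicRep` ∕ `rankOne_theta_twist_rigidity(_split)` for the family's members.
[cite: Liu2021, App. D Lemma D.1 (3) (l. 5233)] [cite: MoeglinVignerasWaldspurger1987, Chap. 2 II.1, Chap. 3 I.1] -/
theorem areIsomorphicRep_theta_lineTransportSection_of_areIsomorphicRep_quot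
    (hV : TV'.IsSymm) (hVd : IsUnit TV'.det) (hJV : JV' = TV'.map (algebraMap F E)) (hn : 3 ≤ N)
    {ι : Type} (aOf : ι → Fˣ) (χOf : ι → Chi F E c)
    (𝓢Of : ∀ i, LocalSplitting.FinLocalSplittings F E c N hcδ hδ hd (gram F (Equiv.prodUnique (Fin N) (Fin 1)) TV' (TW F (aOf i)))
      (isSymm_gram F (Equiv.prodUnique (Fin N) (Fin 1)) hV (isSymm_TW F (aOf i)))
      (reindex_kronecker_eq_gram_map F E (Equiv.prodUnique (Fin N) (Fin 1)) hJV (JW_eq F E (aOf i))))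
    (μOf : ι → ∀ v : HeightOneSpectrum (𝓞 F), (LocalRing E v)ˣ →* ℂˣ) (hμn : ∀ i v x, ‖((μOf i v x : ℂˣ) : ℂ)‖ = 1)
    (hμc : ∀ i v, Continuous fun x => ((μOf i v x : ℂˣ) : ℂ))
    (hμF : ∀ (i : ι) (v : HeightOneSpectrum (𝓞 F)) (t : (v.adicCompletion F)ˣ),
      μOf i v (Units.map (algebraMap (v.adicCompletion F) (LocalRing E v)).toMonoidHom t) = 1 ↔
        ∃ x : (LocalRing E v)ˣ, (x : LocalRing E v) * conjLocal E c v x = algebraMap (v.adicCompletion F) (LocalRing E v) t)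
    (v : HeightOneSpectrum (𝓞 F)) (i j : ι) (J₁ : Matrix (Fin 1) (Fin 1) E) (hJ₁ : J₁ 0 0 ≠ 0)
    (hiso : AreIsomorphicRep
      ((localIndexedFamilyAtV F E c N (Equiv.prodUnique (Fin N) (Fin 1)) JV' hcδ hδ hd hV hVd hJV hn aOf χOf 𝓢Of μOf hμn hμc hμF v).quot j)
      ((localIndexedFamilyAtV F E c N (Equiv.prodUnique (Fin N) (Fin 1)) JV' hcδ hδ hd hV hVd hJV hn aOf χOf 𝓢Of μOf hμn hμc hμF v).quot i)) :
    AreIsomorphicRep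
      (TwistedCoinv.rep
        (ρW := show Representation ℂ (localPi E c 1 J₁ v) (SchwartzBruhat (Fin N → v.adicCompletion F)) from
          ((MpPsi.toRep (localSchrodinger F N TV' v)).comp
            (lineTransportSection F E c N hcδ hδ hd TV' hV JV' hJV (aOf j) v ((𝓢Of j).s v) ((𝓢Of j).proj_s v))).comp
            (localCenter E c N JV' J₁ hJ₁ v))
        (localCharOfCenter F E c J₁ hJ₁ (χOf j).1 v)
        ((MpPsi.toRep (localSchrodinger F N TV' v)).comp
          (lineTransportSection F E c N hcδ hδ hd TV' hV JV' hJV (aOf j) v ((𝓢Of j).s v) ((𝓢Of j).proj_s v)))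
        (fun g z => (show Commute g (localCenter E c N JV' J₁ hJ₁ v z) from localCenter_comm E c N JV' J₁ hJ₁ v z g).map
          ((MpPsi.toRep (localSchrodinger F N TV' v)).comp
            (lineTransportSection F E c N hcδ hδ hd TV' hV JV' hJV (aOf j) v ((𝓢Of j).s v) ((𝓢Of j).proj_s v)))))
      (TwistedCoinv.rep
        (ρW := show Representation ℂ (localPi E c 1 J₁ v) (SchwartzBruhat (Fin N → v.adicCompletion F)) from
          ((MpPsi.toRep (localSchrodinger F N TV' v)).comp
            (lineTransportSection F E c N hcδ hδ hd TV' hV JV' hJV (aOf i) v ((𝓢Of i).s v) ((𝓢Of i).proj_s v))).comp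
            (localCenter E c N JV' J₁ hJ₁ v))
        (localCharOfCenter F E c J₁ hJ₁ (χOf i).1 v)
        ((MpPsi.toRep (localSchrodinger F N TV' v)).comp
          (lineTransportSection F E c N hcδ hδ hd TV' hV JV' hJV (aOf i) v ((𝓢Of i).s v) ((𝓢Of i).proj_s v)))
        (fun g z => (show Commute g (localCenter E c N JV' J₁ hJ₁ v z) from localCenter_comm E c N JV' J₁ hJ₁ v z g).map
          ((MpPsi.toRep (localSchrodinger F N TV' v)).comp
            (lineTransportSection F E c N hcδ hδ hd TV' hV JV' hJV (aOf i) v ((𝓢Of i).s v) ((𝓢Of i).proj_s v))))) := by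
  have hj := areIsomorphicRep_theta_comp_uEquiv_quot F E c N (Equiv.prodUnique (Fin N) (Fin 1)) JV' hcδ hδ hd hV hVd hJV hn aOf χOf 𝓢Of
    μOf hμn hμc hμF v j (lineTransportSection F E c N hcδ hδ hd TV' hV JV' hJV (aOf j) v ((𝓢Of j).s v) ((𝓢Of j).proj_s v))
    (LinearEquiv.refl ℂ _)
    (fun g Φ => LinearMap.congr_fun
      (DFunLike.congr_fun (omega_lineTransportSection_finLocalSplittings F E c N hcδ hδ hd TV' hV JV' hJV (aOf j) v (𝓢Of j)) g) Φ)
    J₁ hJ₁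
  have hi := areIsomorphicRep_theta_comp_uEquiv_quot F E c N (Equiv.prodUnique (Fin N) (Fin 1)) JV' hcδ hδ hd hV hVd hJV hn aOf χOf 𝓢Of
    μOf hμn hμc hμF v i (lineTransportSection F E c N hcδ hδ hd TV' hV JV' hJV (aOf i) v ((𝓢Of i).s v) ((𝓢Of i).proj_s v))
    (LinearEquiv.refl ℂ _)
    (fun g Φ => LinearMap.congr_fun
      (DFunLike.congr_fun (omega_lineTransportSection_finLocalSplittings F E c N hcδ hδ hd TV' hV JV' hJV (aOf i) v (𝓢Of i)) g) Φ)
    J₁ hJ₁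
  exact AreIsomorphicRep.of_comp_surjective _
    (LemD1OfPlace.uEquiv E v c N JV' hcδ hδ (by omega) (transpose_map_conj_JV F E c N JV' hV hJV) (det_JV_ne_zero F E N JV' hVd hJV)).surjective
    ((hj.trans hiso).trans hi.symm)

end Consumer

/-- **`Θ_{s_t}(χ_{t,v}) ≠ 0` at a NON-SPLIT place, `N = 3`, for the transported section of any member `t`** and any line `J₁` presenting the
centre: [MoeglinVignerasWaldspurger1987, Chap. 3 IV.2] PROVED (`mvw_IV2_rankOne_nonvanishing_of_isotropic_holds`) at the isotropic rank-3
space `(E_v³, J_V)` (`LemD1OfPlace.isIsotropic_standingData_of_three_le`), the section `s_t` being over `ι_{a_t⁻¹δ}` (`proj_lineTransportSection`)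
and smooth (`isSmooth_lineTransportSection`).  The `hnt` input of `rankOne_theta_epsClass_and_char_eq_of_areIsomorphicRep` ∕
`rankOne_theta_twist_rigidity` for the family's members. [cite: MoeglinVignerasWaldspurger1987, Chap. 3 IV.2] [cite: Liu2021, App. D Lemma D.1 (1) (l. 5229)] -/
theorem nontrivial_thetaCoinv_lineTransportSection_of_isField
    (hV : TV.IsSymm) (hVd : IsUnit TV.det) (hJV : JV = TV.map (algebraMap F E))
    {ι : Type} (aOf : ι → Fˣ) (χOf : ι → Chi F E c)
    (𝓢Of : ∀ i, LocalSplitting.FinLocalSplittings F E c 3 hcδ hδ hd (gram F (Equiv.prodUnique (Fin 3) (Fin 1)) TV (TW F (aOf i)))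
      (isSymm_gram F (Equiv.prodUnique (Fin 3) (Fin 1)) hV (isSymm_TW F (aOf i)))
      (reindex_kronecker_eq_gram_map F E (Equiv.prodUnique (Fin 3) (Fin 1)) hJV (JW_eq F E (aOf i))))
    (v : HeightOneSpectrum (𝓞 F)) (hE : IsField (LocalRing E v)) (t : ι) (J₁ : Matrix (Fin 1) (Fin 1) E) (hJ₁ : J₁ 0 0 ≠ 0) :
    Nontrivial (TwistedCoinv.Coinv
      ((show Representation ℂ (localPi E c 1 J₁ v) (SchwartzBruhat (Fin 3 → v.adicCompletion F)) from
        ((MpPsi.toRep (localSchrodinger F 3 TV v)).comp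
          (lineTransportSection F E c 3 hcδ hδ hd TV hV JV hJV (aOf t) v ((𝓢Of t).s v) ((𝓢Of t).proj_s v))).comp
          (localCenter E c 3 JV J₁ hJ₁ v)))
      (localCharOfCenter F E c J₁ hJ₁ (χOf t).1 v)) :=
  mvw_IV2_rankOne_nonvanishing_of_isotropic_holds F E c 3 _ (conj_lineDelta hcδ (aOf t)) (lineDelta_ne_zero hδ (aOf t)) _
    (lineDelta_mul_self hd (aOf t)) TV hV hVd JV hJV v hE (by norm_num) (transpose_map_conj_JV F E c 3 JV hV hJV) (det_JV_ne_zero F E 3 JV hVd hJV)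
    (LemD1OfPlace.isIsotropic_standingData_of_three_le E v c 3 JV (conj_lineDelta hcδ (aOf t)) (lineDelta_ne_zero hδ (aOf t)) (by norm_num)
      (transpose_map_conj_JV F E c 3 JV hV hJV) (det_JV_ne_zero F E 3 JV hVd hJV) le_rfl)
    _ (proj_lineTransportSection F E c 3 hcδ hδ hd TV hV JV hJV (aOf t) v ((𝓢Of t).s v) ((𝓢Of t).proj_s v))
    (isSmooth_lineTransportSection F E c 3 hcδ hδ hd TV hV JV hJV (aOf t) v ((𝓢Of t).s v) ((𝓢Of t).proj_s v) ((𝓢Of t).smooth v))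
    J₁ hJ₁ (localCharOfCenter F E c J₁ hJ₁ (χOf t).1 v)
    (norm_localCharOfCenter F E c J₁ hJ₁ (norm_chi_eq_one F E c (Algebra.IsQuadraticExtension.finrank_eq_two F E)
      (UnitaryGroup.algEquiv_ne_one_of_apply_eq_neg F E c hcδ hδ) (χOf t)) v)
    (continuous_coe_localCharOfCenter F E c J₁ hJ₁ (χOf t).2.1 v)

end Literature.NumberTheory.Automorphic.Liu2021.Def411WeilCarriers

end
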